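import Summits.ResolutionOfSingularities.ResolutionOfSingularities.Theorems.WeightedInvariantKeyRungThreeOfDropPointSigma
import Summits.ResolutionOfSingularities.ResolutionOfSingularities.Theorems.WeightedInvariantKeyRungThreeOfDropPointEps
import Summits.ResolutionOfSingularities.ResolutionOfSingularities.Theorems.WeightedInvariantIota3IsoSuccOffExceptional
import HarnessLib

/-!
# (D-b³-point-STAT), TIE regime, successors OFF the strict transform of the equimultiple curve: `ι₃ᵗ` DROPS (the `τ`-letter falls)
# (door `HypersurfaceCentreConstruction`, stmt-ResolutionOfSingularities-19897, stub `stub_keyRungGrHomLE_three`, residual (D-b³-point-STAT-REST))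

Topic: `Summits/ResolutionOfSingularities/ResolutionOfSingularities/Theorems`.  DEF-FREE.  Helper `--supports stmt-ResolutionOfSingularities-19897`.

First cut of the TIE point regime `(ε, τ)(S, f) = (0, 1)` of (D-b³-point-STAT-REST) (…KeyRungThreeOfDropPointIso / …PointSigma): the centre is
still `J₃ᵗ = jSigmaPt` (`ε ≠ 1`), so this hand's (iso-succ) PART C applies on `V(t⁻¹)` (…KeyRungThreeOfDropPointEps), and off `V(t⁻¹)` the transform
reads the order downstairs (…IsoSuccOffExceptional).  Hence:

* `Iota3.isIsolatedPosition_of_forall_iotaOrd_lt` — generic: if `ν ≤ ord_{B_𝔫}(g/1)` and `ord_{B_𝔮}(g/1) < ν` at every prime `𝔮 < 𝔫`, then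
  `(B_𝔫, g/1)` is an ISOLATED position.
* `Iota3.pointStat_succ_bookkeeping_of_eps_ne_one` — at a point start with `ε ≠ 1` (ISOLATED or TIE), every presentation: the successor ring
  `B_𝔫` is regular local of dimension `≤ 3` and the transform has order exactly `ν` there.
* `Iota3.isIsolatedPosition_succ_offStrictTransform` — `ε ≠ 1`, successor with no prime below it missing `t⁻¹` over `Σ(S,f)`: ISOLATED.
* **`Iota3.pointStat_tie_offStrictTransform`** — in the binders of (D-b³-point-STAT) at a start with `ε(S, f) = 0`, `τ(S, f) = 1` (TIE), for every
  presentation of `J₃ᵗ` and every order-stationary `t`-homogeneous successor `𝔫` SUCH THAT no prime `𝔮 < 𝔫` missing `t⁻¹` lies over the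
  equimultiple locus `Σ(S, f)` (the successor is OFF the strict transform of the equimultiple curve): **`ι₃ᵗ(B_𝔫, g/1) < ι₃ᵗ(S, f)`** — the
  successor is isolated, regular, of dimension `≤ 3` and of order exactly `ν`, so `ι₀(B_𝔫, g/1) = ω·(ω·ν) < ω·(ω·ν) + 1 = ι₀(S, f)`.

What remains of the TIE regime: the order-stationary `t`-homogeneous successors ON the strict transform of the equimultiple curve `V(P₀)` (there
`Σ(B_𝔫, g/1) ⊇` the strict transform; `ε`, `τ`, `σ` to be compared), and the CROSSING regime.

[OURS · L1 W4.3 · audit glue over this hand's kernel theorems; AI work, weaker than expert review; nothing here is a statement of the manuscript under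
review (Hironaka 2017, [claim: Hironaka2017, status: under-review]).]

## References

* D. Abramovich, M. Temkin, J. Włodarczyk, *Functorial embedded resolution via weighted blowings up*, Algebra & Number Theory 18 (2024), §5. [AbramovichTemkinWlodarczyk2024]
* J. Włodarczyk, *Functorial resolution by torus actions*, arXiv:2203.03090, §3.3. [Wlodarczyk2022]
-/

noncomputable section

set_option linter.dupNamespace false -- mandated namespace of this single-conjunct summit

open IsLocalRing Literature.AlgebraicGeometry.Resolution
open Summit.ResolutionOfSingularities.ResolutionOfSingularities.Theorems
open Summit.ResolutionOfSingularities.ResolutionOfSingularities.Theorems.ContactCylinder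

namespace Summit.ResolutionOfSingularities.ResolutionOfSingularities.Cruxes.HypersurfaceCentreConstruction.LocalEngine

namespace Iota3

/-- **Isolation from the order drop below** (generic): `ν ≤ ord_{B_𝔫}(g/1)` and `ord_{B_𝔮}(g/1) < ν` for every prime `𝔮 < 𝔫` make
`(B_𝔫, g/1)` an ISOLATED position. [OURS · L1 W4.3] -/
theorem isIsolatedPosition_of_forall_iotaOrd_lt {B : Type} [CommRing B] (𝔫 : Ideal B) [𝔫.IsPrime] (g : B) {ν : ℕ}
    (hν : (ν : Ordinal.{0}) ≤ iotaOrd (Localization.AtPrime 𝔫) (algebraMap B (Localization.AtPrime 𝔫) g))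
    (hbelow : ∀ (𝔮 : Ideal B) [𝔮.IsPrime], 𝔮 < 𝔫 →
      iotaOrd (Localization.AtPrime 𝔮) (algebraMap B (Localization.AtPrime 𝔮) g) < ν) :
    IsIsolatedPosition (Localization.AtPrime 𝔫) (algebraMap B (Localization.AtPrime 𝔫) g) := by
  unfold IsIsolatedPosition
  rw [topStratum_iotaOrd_eq_setOf_map_le 𝔫 (Localization.AtPrime 𝔫) g 𝔫 ?_, Localization.AtPrime.map_eq_maximalIdeal]
  intro 𝔮 _ hle
  constructor
  · intro h
    exact iotaOrd_atPrime_congr (le_antisymm hle h) g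
  · intro h
    by_contra hnle
    have hlt : 𝔮 < 𝔫 := lt_of_le_of_ne hle fun e => hnle e.ge
    have h' := hbelow 𝔮 hlt
    rw [h] at h'
    exact absurd (lt_of_le_of_lt hν h') (lt_irrefl _)

/-- **Successor bookkeeping at a point start with `ε ≠ 1`** (ISOLATED or TIE): the successor ring is regular local of Krull dimension `≤ 3`, and the
transform has order exactly `ν` there (`g/1 ∉ 𝔪_𝔫^{ν+1}`) — every presentation of `J₃ᵗ`. [OURS · L1 W4.3] -/
theorem pointStat_succ_bookkeeping_of_eps_ne_one (p : ℕ) (k₀ : Type) [Field k₀] [CharP k₀ p] [PerfectField k₀]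
    (S : Type) [CommRing S] [Algebra k₀ S] [Algebra.EssFiniteType k₀ S] [IsRegularLocalRing S]
    (f : S) (hd : ringKrullDim S = 3) (hf0 : f ≠ 0) (hf2 : f ∈ (maximalIdeal S) ^ 2)
    (P : Ideal S) [P.IsPrime] (hE : topStratum iotaOrdEpsTau S f = {𝔮 | P ≤ 𝔮.asIdeal}) (hPm : P = maximalIdeal S)
    (hε' : iotaEps S f ≠ 1)
    (n : ℕ) (u : Fin n → S) (w : Fin n → ℕ) (h1 : Ideal.span (Set.range u) = maximalIdeal S) (h2 : (maximalIdeal S).spanFinrank = n)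
    (h5 : ∀ m : ℕ, weightedMonomialIdeal u w m = jFlatT S f m)
    (𝔫 : Ideal (cobordantAlgebra' u w)) [𝔫.IsPrime] (hhom : IsTHomogeneous u w 𝔫) (hT : cobordantT' u w ∈ 𝔫)
    (hV : ¬ extReesAlgebra.vertexIdeal (weightedMonomialIdeal u w) ≤ 𝔫)
    (a : ℕ) (g : cobordantAlgebra' u w) (hfg : algebraMap S (cobordantAlgebra' u w) f = cobordantT' u w ^ a * g)
    (hTg : ¬ cobordantT' u w ∣ g)
    (ν : ℕ) (hfν : f ∈ maximalIdeal S ^ ν) (hfν1 : f ∉ maximalIdeal S ^ (ν + 1)) :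
    IsRegularLocalRing (Localization.AtPrime 𝔫) ∧ ringKrullDim (Localization.AtPrime 𝔫) ≤ 3 ∧
      algebraMap (cobordantAlgebra' u w) (Localization.AtPrime 𝔫) g ∉ maximalIdeal (Localization.AtPrime 𝔫) ^ (ν + 1) := by
  subst hPm
  have hreg : IsRegularLocalRing (Localization.AtPrime 𝔫) := isRegularLocalRing_localization_cobordantAlgebra' u w h1 h2 𝔫 hT
  have hν : 0 < ν := by
    by_contra hν0
    have hν0' : ν = 0 := by omega
    subst hν0'
    exact hfν1 (by rw [zero_add, pow_one]; exact Ideal.pow_le_self two_ne_zero hf2)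
  have hfu : ¬ IsUnit f := (IsLocalRing.mem_maximalIdeal _).mp (Ideal.pow_le_self two_ne_zero hf2)
  have htop : topStratumPrime iotaOrdEpsTau S f = maximalIdeal S := topStratumPrime_eq_maximalIdeal_of_topStratum_eq _ S f hE
  have hdim' : ringKrullDim S = (3 : ℕ) := by rw [hd]; norm_cast
  have hd2 : ¬ ringKrullDim S ≤ 2 := by rw [hd]; decide
  have hd3 : (maximalIdeal S).spanFinrank = 3 := spanFinrank_eq_three_of_ringKrullDim hd
  obtain ⟨g₁, g₂, q, r₁, r₂, hmax, hprim⟩ :=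
    sigmaMaximiserExistsLE3_of_atLevel p (twoFlagDominanceAtLevelLE3Body_holds p) k₀ S f hdim' hf0 hf2 htop hε'
  obtain ⟨x, h𝔪, -⟩ := exists_span_triple_of_isTwoFlag S hdim' g₁ g₂ hmax.2.1
  have hcan := jSigmaCanonicalLE3_of_atLevel p (twoFlagDominanceAtLevelLE3Body_holds p) k₀ S f hdim' hf0 hf2 htop hε'
  have hJ : ∀ m, jFlatT S f m = weightedMonomialIdeal ![x, g₂, g₁] ![q, r₂, r₁] m := fun m =>
    jFlatT_eq_weightedMonomialIdeal_of_canonicalAt hf0 hfu htop hd2 hε' hcan hmax hprim h𝔪 m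
  have hI : weightedMonomialIdeal u w = weightedMonomialIdeal ![x, g₂, g₁] ![q, r₂, r₁] := funext fun m => (h5 m).trans (hJ m)
  obtain ⟨hq, hq₂, h₂₁⟩ := hmax.1
  have hw : ∀ i, 0 < (![q, r₂, r₁] : Fin 3 → ℕ) i := vec3_pos hq hq₂ h₂₁
  have hu' : Ideal.span (Set.range ![x, g₂, g₁]) = maximalIdeal S := by rw [range_vec₃]; exact h𝔪
  have hu'' : ∀ i, (![x, g₂, g₁] : Fin 3 → S) i ∈ Ideal.span (Set.range ![x, g₂, g₁]) := fun i => Ideal.subset_span ⟨i, rfl⟩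
  have hdimB : ringKrullDim (Localization.AtPrime 𝔫) ≤ 3 := by
    have h := ringKrullDim_localization_le_of_eq ![x, g₂, g₁] ![q, r₂, r₁] hu' hd3 hw hI 𝔫 hT hhom hV
    exact_mod_cast h
  have hadic : (adicOrder f).toNat = ν := adicOrder_toNat_eq_of_mem_of_not_mem hfν hfν1
  rw [hadic] at hmax
  have hfJ : f ∈ weightedMonomialIdeal ![x, g₂, g₁] ![q, r₂, r₁] (r₁ * ν) := hmax.mem_weightedMonomialIdeal h𝔪
  obtain ⟨Δ, c, -, hm, hrem⟩ :=
    LocalGameEFTNewton.exists_unitExpansion_of_mem_weightedMonomialIdeal ![x, g₂, g₁] hu' ![q, r₂, r₁] hfJ (r₁ * ν + 1)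
  set r : S := f - ∑ α ∈ Δ, c α * ∏ i, (![x, g₂, g₁] : Fin 3 → S) i ^ α i with hrdef
  have hf : f = ∑ α ∈ Δ, c α * ∏ i, (![x, g₂, g₁] : Fin 3 → S) i ^ α i + r := by rw [hrdef]; ring
  have hN : 0 < r₁ * ν + 1 := Nat.succ_pos _
  have hmN : r₁ * ν < r₁ * ν + 1 := Nat.lt_succ_self _
  have hNν : ν + 1 ≤ r₁ * ν + 1 := by nlinarith
  have hr' : r ∈ Ideal.span (Set.range ![x, g₂, g₁]) ^ (r₁ * ν + 1) := by rw [hu']; exact hrem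
  have hford : f ∉ Ideal.span (Set.range ![x, g₂, g₁]) ^ (ν + 1) := by rw [hu']; exact hfν1
  have hm2 : ∀ β ∈ Δ, (![q, r₂, r₁] : Fin 3 → ℕ) 2 * ν ≤ ∑ i, (![q, r₂, r₁] : Fin 3 → ℕ) i * β i :=
    fun β hβ => by
      change r₁ * ν ≤ _
      exact hm β hβ
  obtain ⟨α, hαΔ, hαdeg, hαunit⟩ := exists_mem_degree_eq_and_not_mem (ν := ν) (N := r₁ * ν + 1)
    (Ideal.span (Set.range ![x, g₂, g₁])) ![x, g₂, g₁] hu'' ![q, r₂, r₁] 2 (vec3_le_two hq₂ h₂₁) (hw 2) hNν Δ c hm2 hr' hf hford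
  have hwα : ∑ i, (![q, r₂, r₁] : Fin 3 → ℕ) i * α i = r₁ * ν := by
    refine le_antisymm ?_ (hm α hαΔ)
    calc ∑ i, (![q, r₂, r₁] : Fin 3 → ℕ) i * α i ≤ ∑ i, r₁ * α i :=
          Finset.sum_le_sum fun i _ => Nat.mul_le_mul_right _ (vec3_le_two hq₂ h₂₁ i)
      _ = r₁ * ν := by rw [← Finset.mul_sum, hαdeg]
  have hunit : IsUnit (c α) := by
    rw [hu'] at hαunit
    simpa [IsLocalRing.mem_maximalIdeal, mem_nonunits_iff] using hαunit
  have hordle := iotaOrd_transform_le_of_isUnit_coeff_of_eq ![x, g₂, g₁] ![q, r₂, r₁] hu' hd3 hw Δ c (r₁ * ν) hN hrem hm hmN hf hαΔ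
    hwα hunit hI 𝔫 hT hfg hTg
  rw [hαdeg] at hordle
  have hlt : iotaOrd (Localization.AtPrime 𝔫) (algebraMap (cobordantAlgebra' u w) (Localization.AtPrime 𝔫) g) <
      ((ν + 1 : ℕ) : Ordinal.{0}) :=
    lt_of_le_of_lt hordle (Nat.cast_lt.mpr (Nat.lt_succ_self ν))
  exact ⟨hreg, hdimB, fun h => absurd ((natCast_le_iotaOrd_iff (Localization.AtPrime 𝔫)
    (algebraMap (cobordantAlgebra' u w) (Localization.AtPrime 𝔫) g) (ν + 1)).mpr h) (not_le.mpr hlt)⟩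

/-- **TIE / ISOLATED start, successor off the strict transform of the equimultiple locus: the successor is ISOLATED** (`ε(S,f) ≠ 1`; no prime
`𝔮 < 𝔫` missing `t⁻¹` lies over `Σ(S, f)`). [OURS · L1 W4.3] -/
theorem isIsolatedPosition_succ_offStrictTransform (p : ℕ) (k₀ : Type) [Field k₀] [CharP k₀ p] [PerfectField k₀]
    (S : Type) [CommRing S] [Algebra k₀ S] [Algebra.EssFiniteType k₀ S] [IsRegularLocalRing S]
    (f : S) (hd : ringKrullDim S = 3) (hf0 : f ≠ 0) (hf2 : f ∈ (maximalIdeal S) ^ 2)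
    (P : Ideal S) [P.IsPrime] (hE : topStratum iotaOrdEpsTau S f = {𝔮 | P ≤ 𝔮.asIdeal}) (hPm : P = maximalIdeal S)
    (hε' : iotaEps S f ≠ 1)
    (n : ℕ) (u : Fin n → S) (w : Fin n → ℕ) (_h1 : Ideal.span (Set.range u) = maximalIdeal S) (_h2 : (maximalIdeal S).spanFinrank = n)
    (h5 : ∀ m : ℕ, weightedMonomialIdeal u w m = jFlatT S f m)
    (𝔫 : Ideal (cobordantAlgebra' u w)) [𝔫.IsPrime] (hhom : IsTHomogeneous u w 𝔫) (_hT : cobordantT' u w ∈ 𝔫)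
    (hV : ¬ extReesAlgebra.vertexIdeal (weightedMonomialIdeal u w) ≤ 𝔫)
    (a : ℕ) (g : cobordantAlgebra' u w) (hfg : algebraMap S (cobordantAlgebra' u w) f = cobordantT' u w ^ a * g)
    (hTg : ¬ cobordantT' u w ∣ g)
    (ν : ℕ) (hfν : f ∈ maximalIdeal S ^ ν) (hfν1 : f ∉ maximalIdeal S ^ (ν + 1))
    (hgν : algebraMap (cobordantAlgebra' u w) (Localization.AtPrime 𝔫) g ∈ maximalIdeal (Localization.AtPrime 𝔫) ^ ν)
    (hoff : ∀ (𝔮 : Ideal (cobordantAlgebra' u w)) [𝔮.IsPrime], 𝔮 < 𝔫 → cobordantT' u w ∉ 𝔮 →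
      (⟨𝔮.comap (algebraMap S (cobordantAlgebra' u w)), Ideal.IsPrime.comap _⟩ : PrimeSpectrum S) ∉ topStratum iotaOrd S f) :
    IsIsolatedPosition (Localization.AtPrime 𝔫) (algebraMap (cobordantAlgebra' u w) (Localization.AtPrime 𝔫) g) ∧
      ∀ (𝔮 : Ideal (cobordantAlgebra' u w)) [𝔮.IsPrime], 𝔮 < 𝔫 →
        iotaOrd (Localization.AtPrime 𝔮) (algebraMap (cobordantAlgebra' u w) (Localization.AtPrime 𝔮) g) < ν := by
  have hνS : iotaOrd S f = ν := (iotaOrd_eq_natCast_iff S f ν).mpr ⟨hfν, hfν1⟩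
  have hbelowT := pointStat_below_exceptional p k₀ S f hd hf0 hf2 P hE hPm hε' n u w h5 𝔫 hhom hV a g hfg hTg ν hfν hfν1
  have hbelow : ∀ (𝔮 : Ideal (cobordantAlgebra' u w)) [𝔮.IsPrime], 𝔮 < 𝔫 →
      iotaOrd (Localization.AtPrime 𝔮) (algebraMap (cobordantAlgebra' u w) (Localization.AtPrime 𝔮) g) < ν := by
    intro 𝔮 _ hlt
    by_cases hT𝔮 : cobordantT' u w ∈ 𝔮
    · exact hbelowT 𝔮 hT𝔮 hlt
    · have h := LocalGameEFTPointMove.iotaOrd_transform_atPrime_lt_of_not_mem_topStratum u w 𝔮 hT𝔮 hfg (hoff 𝔮 hlt hT𝔮)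
      rwa [hνS] at h
  have hν₁ : (ν : Ordinal.{0}) ≤ iotaOrd (Localization.AtPrime 𝔫) (algebraMap (cobordantAlgebra' u w) (Localization.AtPrime 𝔫) g) :=
    (natCast_le_iotaOrd_iff (Localization.AtPrime 𝔫) (algebraMap (cobordantAlgebra' u w) (Localization.AtPrime 𝔫) g) ν).mpr hgν
  exact ⟨isIsolatedPosition_of_forall_iotaOrd_lt 𝔫 g hν₁ hbelow, hbelow⟩

/-- **(D-b³-point-STAT), TIE regime, OFF the strict transform of the equimultiple curve: `ι₃ᵗ` drops.** [OURS · L1 W4.3] -/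
theorem pointStat_tie_offStrictTransform (p : ℕ) (k₀ : Type) [Field k₀] [CharP k₀ p] [PerfectField k₀]
    (S : Type) [CommRing S] [Algebra k₀ S] [Algebra.EssFiniteType k₀ S] [IsRegularLocalRing S]
    (f : S) (hd : ringKrullDim S = 3) (hf0 : f ≠ 0) (hf2 : f ∈ (maximalIdeal S) ^ 2)
    (P : Ideal S) [P.IsPrime] (hE : topStratum iotaOrdEpsTau S f = {𝔮 | P ≤ 𝔮.asIdeal}) (hPm : P = maximalIdeal S)
    (hε : iotaEps S f = 0) (hτ : iotaTau S f = 1)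
    (n : ℕ) (u : Fin n → S) (w : Fin n → ℕ) (h1 : Ideal.span (Set.range u) = maximalIdeal S) (h2 : (maximalIdeal S).spanFinrank = n)
    (h5 : ∀ m : ℕ, weightedMonomialIdeal u w m = jFlatT S f m)
    (𝔫 : Ideal (cobordantAlgebra' u w)) [𝔫.IsPrime] (hhom : IsTHomogeneous u w 𝔫) (hT : cobordantT' u w ∈ 𝔫)
    (hV : ¬ extReesAlgebra.vertexIdeal (weightedMonomialIdeal u w) ≤ 𝔫)
    (a : ℕ) (g : cobordantAlgebra' u w) (hfg : algebraMap S (cobordantAlgebra' u w) f = cobordantT' u w ^ a * g)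
    (hTg : ¬ cobordantT' u w ∣ g)
    (ν : ℕ) (hfν : f ∈ maximalIdeal S ^ ν) (hfν1 : f ∉ maximalIdeal S ^ (ν + 1))
    (hgν : algebraMap (cobordantAlgebra' u w) (Localization.AtPrime 𝔫) g ∈ maximalIdeal (Localization.AtPrime 𝔫) ^ ν)
    (hoff : ∀ (𝔮 : Ideal (cobordantAlgebra' u w)) [𝔮.IsPrime], 𝔮 < 𝔫 → cobordantT' u w ∉ 𝔮 →
      (⟨𝔮.comap (algebraMap S (cobordantAlgebra' u w)), Ideal.IsPrime.comap _⟩ : PrimeSpectrum S) ∉ topStratum iotaOrd S f) :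
    iotaFlatT (Localization.AtPrime 𝔫) (algebraMap (cobordantAlgebra' u w) (Localization.AtPrime 𝔫) g) < iotaFlatT S f := by
  have hε' : iotaEps S f ≠ 1 := by rw [hε]; exact zero_ne_one
  have hνS : iotaOrd S f = ν := (iotaOrd_eq_natCast_iff S f ν).mpr ⟨hfν, hfν1⟩
  have hν : 0 < ν := by
    by_contra hν0
    have hν0' : ν = 0 := by omega
    subst hν0'
    exact hfν1 (by rw [zero_add, pow_one]; exact Ideal.pow_le_self two_ne_zero hf2)
  obtain ⟨hreg, hdimB, hgν1⟩ :=
    pointStat_succ_bookkeeping_of_eps_ne_one p k₀ S f hd hf0 hf2 P hE hPm hε' n u w h1 h2 h5 𝔫 hhom hT hV a g hfg hTg ν hfν hfν1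
  obtain ⟨hisoB, -⟩ :=
    isIsolatedPosition_succ_offStrictTransform p k₀ S f hd hf0 hf2 P hE hPm hε' n u w h1 h2 h5 𝔫 hhom hT hV a g hfg hTg ν hfν hfν1 hgν hoff
  have hι₀B : iotaOrdEpsTau (Localization.AtPrime 𝔫) (algebraMap (cobordantAlgebra' u w) (Localization.AtPrime 𝔫) g) =
      Ordinal.omega0 * (Ordinal.omega0 * (ν : Ordinal.{0})) :=
    @iotaOrdEpsTau_eq_of_isIsolatedPosition (Localization.AtPrime 𝔫) _ hreg _ hdimB ν hν hgν hgν1 hisoB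
  have hι₀S : iotaOrdEpsTau S f = Ordinal.omega0 * (Ordinal.omega0 * (ν : Ordinal.{0})) + 1 := by
    rw [iotaOrdEpsTau_apply, iotaOrdEps_apply, hνS, hε, hτ, add_zero]
  rw [iotaFlatT_lt_iff]
  left
  rw [hι₀B, hι₀S, ← Order.succ_eq_add_one]
  exact Order.lt_succ _

end Iota3

end Summit.ResolutionOfSingularities.ResolutionOfSingularities.Cruxes.HypersurfaceCentreConstruction.LocalEngine

end
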